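import Summits.Ventures.PercRepro.S2ElevenCaps
import Summits.Ventures.PercRepro.S2FlatSharp
import Summits.Ventures.PercRepro.S2TailFlats
import Summits.Ventures.PercRepro.S2SpanningCount
import Summits.Ventures.PercRepro.S2CountsCell
import Summits.Ventures.PercRepro.S2DichotomyTools
import Summits.Ventures.PercRepro.RankLevelSetPlaneTenPrime

/-!
# PercRepro — S2: THE CASE `ν = 6` OF THE COLOOP-FREE CELL `(13, 11)` BY THE FLAT-SHARP LEVER (p7, gen 19; sub-claim S2; the row `p = 13`)

On the coloop-free cell `(13, 11)` (an `e`-free core of rank `13` on `24` points; caps `24 / 225 / 1917`, `K = 9480`), the case `ν = 6`: a set `W` of nullity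
`6` on `≤ 11` points and none of nullity `7` on `≤ 12` — so the rank-`5` sets have `≤ 11` points and the rank-`4` sets `≤ 10`. No contraction:
the spread lever with the triangle term `topCount_le_flat_sharp` at `(f, f′) = (11, 10)` bounds the top count uniformly (`#U ≤ 1680202667 / 4230 <
397212`), the tail by flats at `(11, 10)` is `981253378 / 2115`, and the spanning count goes through `W` (`S2.ncard_spanning_le_of_nullity`:
`≤ 3964955` for `|W| ≤ 11`): `m = 271`, the need `(1024 − 271)·64·9480/1024 = 446152.5` — ratio `0.890` (at `|W| = 10` the count is `3143849`,
`m = 221`; the single bound `3964955` serves both). **`c025_thirteen_eleven_cf_nu_six`**. Nothing about the cell is claimed. Axioms: standard.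
-/

open scoped Matroid

namespace PercRepro

namespace ThmN

open Set

variable {α : Type}

/-- **The case `ν = 6` of the coloop-free cell `(13, 11)`**: a set of nullity `6` on `≤ 11` points, none of nullity `7` on `≤ 12`, by the
flat-sharp lever at `(11, 10)` and the spanning count through the nullity-`6` set (`#U ≤ 397212`, `m = 271`). -/
theorem c025_thirteen_eleven_cf_nu_six (M : Matroid α) [M.Finite]
    (hR : M.eRank = ((13 : ℕ) : ℕ∞)) (hn : M.E.ncard = 13 + 11)
    (hfree : ∀ e ∈ M.E, ∃ A ⊆ M.E \ {e}, e ∉ M.closure A ∧ e ∉ M.closure ((M.E \ {e}) \ A)) (hK : ∀ e, ¬ M.IsColoop e)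
    (h7 : ¬ ∃ W ⊆ M.E, W.ncard ≤ 12 ∧ W.encard = M.eRk W + 7)
    (h6 : ∃ W ⊆ M.E, W.ncard ≤ 11 ∧ W.encard = M.eRk W + 6) :
    RLS M 13 5 := by
  classical
  have hd : M.E.encard = M.eRank + ((11 : ℕ) : ℕ∞) := by
    rw [hR, ← M.ground_finite.cast_ncard_eq, hn]
    push_cast
    ring
  obtain ⟨hs3, hs4, hs5⟩ := caps_thirteen_eleven_cf M hd hn hfree hK
  have hflat : ∀ X ⊆ M.E, M.eRk X ≤ 5 → X.ncard ≤ 11 := fun X hX hr => by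
    have := S2.ncard_le_of_eRk_le_of_not_nullity M 7 12 (by norm_num) h7 hX (r := 5) (by norm_num) (by exact_mod_cast hr)
    omega
  have hflat' : ∀ X ⊆ M.E, M.eRk X ≤ 4 → X.ncard ≤ 10 := fun X hX hr => by
    have := S2.ncard_le_of_eRk_le_of_not_nullity M 7 12 (by norm_num) h7 hX (r := 4) (by norm_num) (by exact_mod_cast hr)
    omega
  -- the top count by the flat-sharp lever at `(11, 10)`
  have hU := topCount_le_flat_sharp M 13 11 (by norm_num) (by norm_num) hR hn hfree 11 10 hflat hflat' (by norm_num) (by norm_num)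
    24 225 1917 hs3 hs4 hs5
  have hU' : Matroid.topCount M 13 5 ≤ 397212 := by
    have h : (Matroid.topCount M 13 5 : ℚ) ≤ 397212 := by
      refine hU.trans ?_
      norm_num [Finset.sum_range_succ, Nat.choose]
    exact_mod_cast h
  -- the tail by flats at `(11, 10)`
  have hA := ncard_eRk_le_five_le_flats M 13 11 (by norm_num) hR hn hfree 11 10 hflat hflat' (by norm_num) (by norm_num)
    (by norm_num) (by norm_num) 24 225 1917 hs3 hs4 hs5
  have hA' : ({X : Set α | X ⊆ M.E ∧ M.eRk X ≤ 5}.ncard : ℚ) ≤ 981253378 / 2115 := by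
    refine hA.trans ?_
    norm_num [Finset.sum_range_succ, Nat.choose]
  -- the spanning count through the nullity-`6` set `W` (`≤ 11` points)
  obtain ⟨W, hW, hWn, hWk⟩ := h6
  have hS' : {X : Set α | X ⊆ M.E ∧ M.eRk X = M.eRank}.ncard ≤ 3964955 := by
    refine (S2.ncard_spanning_le_of_nullity M hW hd hWk).trans ?_
    rw [hn]
    generalize W.ncard = w at hWn ⊢
    interval_cases w <;> decide
  rw [RLS_iff]
  exact c025_core_five_cell_of_counts_xqictq5g M 13 11 (by norm_num) hR hn 397212 hU' _ hA' 3964955 hS'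
    9480 (by norm_num) (phiK 13 5) (by rw [phiK_thirteen_five]; norm_num) ⟨271, by norm_num, by norm_num, by norm_num⟩

end ThmN

end PercRepro
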